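import Literature.Computability.AlgebraicComplexity.BI17GenericPeriodSmallProofs
import Literature.Computability.AlgebraicComplexity.BI17PeriodExponentBoundProofs
import HarnessLib

/-!
# Bürgisser–Ikenmeyer 2017, Thm. 4.2 for all square formats `m = n²` and Cor. 5.12 (2) for
# `3 ≤ m ≤ 6` and all squares — PROOFS from one polystable witness (no Popov, no Luna)

P. Bürgisser, C. Ikenmeyer, *Fundamental invariants of orbit closures*, J. Algebra **477** (2017)
390–434 = arXiv:1511.02927 [BurgisserIkenmeyer2017]. THEOREMS ONLY; sibling of the statement file
`BI17FundamentalInvariantTensors.lean` (val-lit row BI2017-B), whose named facts `BI2017_thm_4_2`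
(Thm. 4.2, TeX L1612: "We have `a(m) = 1` for `m ≥ 3` and `a(2) = 2`") and `BI2017_cor_5_12`
(Cor. 5.12, TeX L2227: "2. Let `m ≥ 3`. Then `\overline{Gw}` is not normal for almost all
`w ∈ ⊗³ℂ^m`") are NOT restated and stay named facts. No new definition, no new named fact.

The printed proofs take the clause `m ≥ 4` of Thm. 4.2 from A. M. Popov's classification of
generic stabilizers (`BI2017_popov_trivialStabilizer`, not held, not proved) and Cor. 5.12 (2) from
Thm. 4.2 together with generic polystability, Prop. 4.10 (Luna's étale slices;
`BI2017_prop_4_10`, not proved) — the tree's bridges `BI2017_thm_4_2_of_popov`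
(`BI17GenericPeriodThreeProofs.lean`) and `BI2017_cor_5_12_of_thm_4_2_of_prop_4_10`
(`BI17PeriodExponentBoundProofs.lean`). This file proves MORE of both facts from what the tree
already has, by a route not in print:

## The witness argument (ours)

* arithmetic (private): if `x ∈ ⟨S⟩ ≤ ℤ` for an additive submonoid `S ⊆ ℕ`, then `x = p - q`
  with `p, q ∈ S`; if `1 ∈ ⟨S⟩` then `S` contains a consecutive pair.
* `add_mem_tensorDegreeMonoid` — `E(w)` is closed under addition (`I(Gw)` is prime,
  `tensorOrbitVanishingIdeal_isPrime`).
* `exists_kronRect_pos_and_kronRect_add_period_pos` — for EVERY polystable `w ≠ 0` in `⊗³ℂ^m`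
  there is `δ` with `k_m(δ) > 0` and `k_m(δ + a(w)) > 0`: by the DISCHARGED Thm. 5.3
  (`BI2017_thm_5_3_holds`: `E(w)` generates `m a(w) ℤ`), `m a(w) = p - q` with `p, q ∈ E(w) ⊆ E(m) =
  {mδ : k_m(δ) > 0}` (`genericTensorDegreeMonoid_eq_kronRect`).
* **`isZariskiGenericTensor_period_eq_one_of_polystable_witness`** — ONE polystable `w₀ ≠ 0` with
  `a(w₀) = 1` in `⊗³ℂ^m` forces `a(m) = 1`: the pair `δ, δ + 1` is coprime, so the tree's criterion
  `isZariskiGenericTensor_period_eq_one_of_kronRect_pos` (x4, `BI17GenericPeriodSmallProofs.lean`)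
  applies. More generally `…_of_polystable_witness_odd`: a polystable `w₀ ≠ 0` of ODD period
  suffices, the unit tensor `⟨m⟩` (polystable of period `2`, tree: `BI2017_cor_4_9_unitTensor_holds`,
  `BI2017_thm_4_3_holds`) supplying the difference `2` (Bezout).
* **`BI2017_thm_4_2_sq : a(n²) = 1` for every `n ≥ 1`** — witness `⟨n,n,n⟩ ∈ ⊗³ℂ^{n²}`
  (polystable, Cor. 4.9 = `isPolystableTensor_biMatMulTensorFin`; period `1`, Cor. 4.6 =
  `tensorStabilizerPeriod_biMatMulTensorFin`); `BI2017_thm_4_2_of_isSquare`; and the named fact is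
  now EQUIVALENT to its clause "`m ≥ 7`, `m` not a square" (`BI2017_thm_4_2_iff_nonsquare_seven_le`).

## Generic non-normality without Prop. 4.10 (ours)

* `mul_mem_tensorDegreeMonoid_of_mem_tensorExponentMonoid` — for EVERY tensor `w` (polystable or
  not): `e ∈ E'(w) ⇒ m a(w) e ∈ E(w)` (invariant lifting from `I(Gw)`,
  `exists_isSL3Invariant_sub_mem_tensorOrbitVanishingIdeal` + `mul_mem_tensorDegreeMonoid_of_lift`).
* **`isZariskiGenericTensor_not_isIntegrallyClosed_of_kronRect_pos_succ`** — if `k_m(δ) > 0` and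
  `k_m(δ+1) > 0` (`m ≥ 2`), then `\overline{Gw}` is NOT normal for almost all `w ∈ ⊗³ℂ^m`: off the
  hypersurface `{F G = 0}` (`F`, `G` nonzero invariants of degrees `mδ`, `m(δ+1)`) one has
  `a(w) = 1` (coprime degrees), `δ, δ+1 ∈ E'(w)` (exact semi-invariance
  `IsSL3Invariant.aeval_tensorPt_actTensor_eq_tensorChi_pow`), and `1 ∉ E'(w)` since otherwise
  `m ∈ E(w) ⊆ E(m)`, i.e. `k_m(1) > 0`, contradicting `k_m(1) = 0` (`kronRect_eq_zero_of_sq_lt`,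
  `m > 1`); the tree's Reynolds-free Thm. 5.8 (3) core
  `not_isIntegrallyClosed_tensorOrbitCoordRing_of_consecutive` (t04 g3) concludes. NO polystability
  of `w` is needed.
* **`BI2017_cor_5_12_part2_of_le_six`** (`3 ≤ m ≤ 6`, kernel certificates `k_3(2),k_3(3)`,
  `k_4(2),k_4(3)`, `k_5(3),k_5(4)`, `k_6(3),k_6(4) > 0` of the tree), **`BI2017_cor_5_12_part2_sq`**
  (every `m = n²`, `n ≥ 2`), `BI2017_cor_5_12_part2_of_polystable_witness`; the printed route per
  `m` (`BI2017_cor_5_12_part2_of_generic`: generic period `1` + generic polystability at `m`), and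
  the named fact reduced to the NON-SQUARE clauses `m ≥ 7` of Thm. 4.2 / Prop. 4.10
  (`BI2017_cor_5_12_of_nonsquare_clauses`, `BI2017_cor_5_12_iff_nonsquare_seven_le`).

## One odd `δ` suffices (ours)

* `two_mem_addSubgroupClosure_kronRect_pos`, `exists_kronRect_pos_succ_of_odd` — the group
  generated by `{δ : k_m(δ) > 0}` always contains `2` (witness `⟨m⟩`, period `2`), so ONE odd `δ`
  with `k_m(δ) > 0` gives a consecutive pair; hence
  `isZariskiGenericTensor_period_eq_one_of_odd_kronRect_pos` and
  `isZariskiGenericTensor_not_isIntegrallyClosed_of_odd_kronRect_pos`.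
* `BI2017_thm_4_2_odd_of_kronRect_self_pos`, `BI2017_cor_5_12_part2_odd_of_kronRect_self_pos` — for
  ODD `m ≥ 3` both statements follow from square Kronecker positivity `k_m(m) > 0`
  (Bessenrodt–Behns 2004, Cor. 3.2: `[λ] ∈ [λ]²` for `λ = λ'`; hypothesis inline here, the cited
  result being typed in its own Literature file), and the two named facts are reduced to that plus
  their EVEN non-square clauses `m ≥ 8` (`BI2017_thm_4_2_of_kronRect_self_pos_of_even_nonsquare`,
  `BI2017_cor_5_12_of_kronRect_self_pos_of_even_nonsquare_clauses`).

* `BI2017_thm_4_2_eight`, `BI2017_cor_5_12_part2_eight` — the format `m = 8` unconditionally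
  (`k_8(3) > 0`, tree certificate `kronRect_eight_three_pos`, odd exponent `3`);
  `BI2017_thm_4_2_iff_residual` / `BI2017_cor_5_12_iff_residual` (the named facts = their clauses
  for `m = 7` or `m ≥ 10` non-square) and the `_ten_le` reductions modulo square positivity.

Honest sizing of what remains: for EVEN non-square `m ≥ 10` a polystable witness of odd period (or
an odd `δ` with `k_m(δ) > 0`) is not in the tree; there the two named facts rest on Popov 1987 /
Luna 1973 exactly as in print. Square positivity `k_m(m) > 0` for odd `m` is a published theorem
(Bessenrodt–Behns 2004) not proved in the tree (for even `m` it follows from Alon–Tarsi via Kumar: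
`kronRect_self_pos_of_latinColCount_ne_zero`).

Honest framing: typed-literature proofs for the cell `val-lit` (LADDER-VALIANT V3, a known-results
layer at a known separation); nothing here bears on VP versus VNP.

## References

* [BurgisserIkenmeyer2017] P. Bürgisser, C. Ikenmeyer, *Fundamental invariants of orbit closures*,
  J. Algebra 477 (2017) 390–434; arXiv:1511.02927, §4.1 Thm. 4.2, Thm. 4.3, Cor. 4.6, Cor. 4.9,
  §5 eq. (5.2), Thm. 5.3, Thm. 5.8 (3), Cor. 5.12.
* C. Bessenrodt, C. Behns, *On the Durfee size of Kronecker products of characters of the symmetric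
  group and its double covers*, J. Algebra 280 (2004) 132–144, Cor. 3.2 and the Remark after it
  (square partitions; Vallejo's question).
* [MumfordFogartyKirwan1994] D. Mumford, J. Fogarty, F. Kirwan, *Geometric Invariant Theory*,
  Ch. 1 §1 (the Reynolds operator; invariant lifting).
-/

noncomputable section

open MvPolynomial Matrix

namespace Literature.Computability.AlgebraicComplexity

/-! ### Arithmetic: differences of a numerical monoid -/

section Arith

/-- If `x` lies in the subgroup of `ℤ` generated by an additive submonoid `S ⊆ ℕ` (`0 ∈ S`,
`S + S ⊆ S`), then `x = p - q` with `p, q ∈ S`. [folklore] -/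
private theorem exists_sub_eq_of_mem_addSubgroupClosure_image {S : Set ℕ} (h0 : 0 ∈ S)
    (hadd : ∀ {a b : ℕ}, a ∈ S → b ∈ S → a + b ∈ S) {x : ℤ}
    (hx : x ∈ AddSubgroup.closure ((fun d : ℕ => (d : ℤ)) '' S)) :
    ∃ p ∈ S, ∃ q ∈ S, x = (p : ℤ) - q := by
  refine AddSubgroup.closure_induction (p := fun x _ => ∃ p ∈ S, ∃ q ∈ S, x = (p : ℤ) - q)
    ?_ ?_ ?_ ?_ hx
  · rintro y ⟨d, hd, rfl⟩
    exact ⟨d, hd, 0, h0, by simp⟩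
  · exact ⟨0, h0, 0, h0, by simp⟩
  · rintro y z _ _ ⟨p, hp, q, hq, rfl⟩ ⟨p', hp', q', hq', rfl⟩
    exact ⟨p + p', hadd hp hp', q + q', hadd hq hq', by push_cast; ring⟩
  · rintro y _ ⟨p, hp, q, hq, rfl⟩
    exact ⟨q, hq, p, hp, by ring⟩

/-- A numerical monoid `S ⊆ ℕ` whose generated subgroup of `ℤ` contains `1` has two CONSECUTIVE
elements `q, q + 1`. [folklore] -/
private theorem exists_succ_mem_of_one_mem_addSubgroupClosure_image {S : Set ℕ} (h0 : 0 ∈ S)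
    (hadd : ∀ {a b : ℕ}, a ∈ S → b ∈ S → a + b ∈ S)
    (h1 : (1 : ℤ) ∈ AddSubgroup.closure ((fun d : ℕ => (d : ℤ)) '' S)) :
    ∃ q ∈ S, q + 1 ∈ S := by
  obtain ⟨p, hp, q, hq, hpq⟩ := exists_sub_eq_of_mem_addSubgroupClosure_image h0 hadd h1
  refine ⟨q, hq, ?_⟩
  have : p = q + 1 := by omega
  rwa [← this]

end Arith

/-! ### The degree monoid is a monoid; exponents give degrees for every tensor -/

section Monoid

variable {ι : Type*} [Fintype ι] [DecidableEq ι]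

/-- `E(w)` is closed under addition: a product of two homogeneous `SL³`-invariants not vanishing on
`Gw` does not vanish on `Gw` (`I(Gw)` is prime). [cite: BurgisserIkenmeyer2017, Def. 5.2] -/
theorem add_mem_tensorDegreeMonoid (w : ι → ι → ι → ℂ) {d e : ℕ} (hd : d ∈ tensorDegreeMonoid w)
    (he : e ∈ tensorDegreeMonoid w) : d + e ∈ tensorDegreeMonoid w := by
  obtain ⟨F, hFh, hFi, hFI⟩ := hd
  obtain ⟨G, hGh, hGi, hGI⟩ := he
  refine ⟨F * G, hFh.mul hGh, hFi.mul hGi, fun h => ?_⟩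
  rcases (tensorOrbitVanishingIdeal_isPrime w).mem_or_mem h with h' | h'
  · exact hFI h'
  · exact hGI h'

/-- **`E'(w) ⊆ E(w) / (m a(w))` for EVERY tensor** (polystable or not): if `e ∈ E'(w)`, i.e. some
polynomial `F` satisfies `F(g·w) = χ(g)^{a(w) e}` on `GL³`, then `m a(w) e ∈ E(w)` — `F` is
`SL³`-invariant as a function on `Gw`, so by invariant lifting
(`exists_isSL3Invariant_sub_mem_tensorOrbitVanishingIdeal`) it is congruent modulo `I(Gw)` to an
`SL³`-invariant `z`, whose degree-`m a(w) e` component does not vanish on `Gw`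
(`mul_mem_tensorDegreeMonoid_of_lift`). The `⊇` half of BI Lemma 5.1 (3) without its polystability
hypothesis. [cite: BurgisserIkenmeyer2017, Lemma 5.1 (3)] -/
theorem mul_mem_tensorDegreeMonoid_of_mem_tensorExponentMonoid [Nonempty ι] (w : ι → ι → ι → ℂ)
    {e : ℕ} (he : e ∈ tensorExponentMonoid w) :
    Fintype.card ι * tensorStabilizerPeriod w * e ∈ tensorDegreeMonoid w := by
  obtain ⟨F, hF⟩ := he
  -- `F` is `SL³`-invariant as a function on `Gw`
  have horb : ∀ (s : Matrix.SpecialLinearGroup ι ℂ × Matrix.SpecialLinearGroup ι ℂ ×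
      Matrix.SpecialLinearGroup ι ℂ) (v : ι → ι → ι → ℂ), v ∈ tensorGLOrbit w →
      aeval (tensorPt (actTensor (s.1 : Matrix ι ι ℂ) (s.2.1 : Matrix ι ι ℂ) (s.2.2 : Matrix ι ι ℂ) v))
        F = aeval (tensorPt v) F := by
    rintro s v ⟨g, rfl⟩
    set g' : GL ι ℂ × GL ι ℂ × GL ι ℂ := (Matrix.SpecialLinearGroup.toGL s.1 * g.1,
      Matrix.SpecialLinearGroup.toGL s.2.1 * g.2.1, Matrix.SpecialLinearGroup.toGL s.2.2 * g.2.2)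
      with hg'
    have hχ : tensorChi g' = tensorChi g := by
      ext
      simp only [hg', tensorChi, Units.val_mul, Matrix.GeneralLinearGroup.val_det_apply,
        Matrix.SpecialLinearGroup.coe_GL_coe_matrix, Matrix.det_mul,
        Matrix.SpecialLinearGroup.det_coe, one_mul]
    have h' := hF g'
    rw [hχ] at h'
    rw [actTensor_actTensor, hF g, ← h']
    simp only [hg', Units.val_mul, Matrix.SpecialLinearGroup.coe_GL_coe_matrix]
  obtain ⟨z, hz, hzF⟩ := exists_isSL3Invariant_sub_mem_tensorOrbitVanishingIdeal w F horb
  refine mul_mem_tensorDegreeMonoid_of_lift w hz fun g => ?_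
  have h0 := mem_tensorOrbitVanishingIdeal_iff.1 hzF g
  rw [map_sub, sub_eq_zero] at h0
  rw [h0, hF g]

/-- A homogeneous `SL³`-invariant of degree `m n` not vanishing at `w` exhibits `n ∈ E'(w)` once
`a(w) = 1`: `F(w)⁻¹ F` extends `φ_w^n` (exact semi-invariance `F(g·w) = χ(g)^n F(w)`).
[cite: BurgisserIkenmeyer2017, §5 (after Thm. 5.3)] -/
theorem mem_tensorExponentMonoid_of_period_eq_one [Nonempty ι] {w : ι → ι → ι → ℂ}
    (ha : tensorStabilizerPeriod w = 1) {F : MvPolynomial (ι × ι × ι) ℂ} {n : ℕ}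
    (hFh : F.IsHomogeneous (Fintype.card ι * n)) (hFi : IsSL3Invariant F)
    (hFw : aeval (tensorPt w) F ≠ 0) : n ∈ tensorExponentMonoid w := by
  refine ⟨C (aeval (tensorPt w) F)⁻¹ * F, fun g => ?_⟩
  rw [map_mul, aeval_C, Algebra.algebraMap_self_apply,
    IsSL3Invariant.aeval_tensorPt_actTensor_eq_tensorChi_pow hFh hFi g w, ha, one_mul,
    mul_comm, mul_assoc, mul_inv_cancel₀ hFw, mul_one]

end Monoid

/-! ### One polystable witness of period one forces `a(m) = 1` -/

section Witness

/-- A nonzero `Fin m`-tensor has `m ≥ 1`. [folklore] -/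
private theorem pos_of_tensor_ne_zero {m : ℕ} {w : Fin m → Fin m → Fin m → ℂ} (hw : w ≠ 0) :
    0 < m := by
  rcases Nat.eq_zero_or_pos m with rfl | hm
  · exact absurd (Subsingleton.elim w 0) hw
  · exact hm

/-- **Two positive rectangular Kronecker coefficients differing by the period**, for EVERY
polystable `w ≠ 0` in `⊗³ℂ^m`: there is `δ` with `k_m(δ) > 0` and `k_m(δ + a(w)) > 0`. By the
discharged Thm. 5.3 (`BI2017_thm_5_3_holds`), `m a(w)` lies in the group generated by `E(w)`, hence
`m a(w) = p - q` with `p, q ∈ E(w)` (`E(w)` is a monoid); and `E(w) ⊆ E(m) = {mδ : k_m(δ) > 0}`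
(eq. (5.2) = `genericTensorDegreeMonoid_eq_kronRect`). [cite: BurgisserIkenmeyer2017, Thm. 5.3 and eq. (5.2)] -/
theorem exists_kronRect_pos_and_kronRect_add_period_pos {m : ℕ} {w : Fin m → Fin m → Fin m → ℂ}
    (hw : w ≠ 0) (hps : IsPolystableTensor w) :
    ∃ δ : ℕ, 0 < kronRect ℂ m δ ∧ 0 < kronRect ℂ m (δ + tensorStabilizerPeriod w) := by
  have hm : 0 < m := pos_of_tensor_ne_zero hw
  have hmem : ((m * tensorStabilizerPeriod w : ℕ) : ℤ) ∈
      AddSubgroup.closure ((fun d : ℕ => (d : ℤ)) '' tensorDegreeMonoid w) := by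
    rw [BI2017_thm_5_3_holds m w hw hps]
    exact AddSubgroup.mem_zmultiples _
  obtain ⟨p, hp, q, hq, hpq⟩ := exists_sub_eq_of_mem_addSubgroupClosure_image
    (zero_mem_tensorDegreeMonoid w) (fun ha hb => add_mem_tensorDegreeMonoid w ha hb) hmem
  have hp' := tensorDegreeMonoid_subset_genericTensorDegreeMonoid w hp
  have hq' := tensorDegreeMonoid_subset_genericTensorDegreeMonoid w hq
  rw [genericTensorDegreeMonoid_eq_kronRect m] at hp' hq'
  obtain ⟨δp, rfl, hδp⟩ := hp'
  obtain ⟨δq, rfl, hδq⟩ := hq'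
  refine ⟨δq, hδq, ?_⟩
  have hδ : δp = δq + tensorStabilizerPeriod w := by
    have h : (m : ℤ) * δp = m * (δq + tensorStabilizerPeriod w) := by
      push_cast at hpq
      linarith
    have hm' : (m : ℤ) ≠ 0 := by exact_mod_cast hm.ne'
    exact_mod_cast mul_left_cancel₀ hm' h
  rw [← hδ]
  exact hδp

/-- `gcd(δ, δ + 1) = 1`. [folklore] -/
private theorem coprime_self_succ (δ : ℕ) : Nat.Coprime δ (δ + 1) := by
  rw [Nat.coprime_self_add_right]
  exact Nat.coprime_one_right δ

/-- **One polystable witness of stabilizer period `1` forces `a(m) = 1`** (ours; the print uses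
Popov's theorem): if `⊗³ℂ^m` contains a polystable `w₀ ≠ 0` with `a(w₀) = 1`, then almost all
`w ∈ ⊗³ℂ^m` have `a(w) = 1` — the consecutive pair `k_m(δ), k_m(δ+1) > 0` of
`exists_kronRect_pos_and_kronRect_add_period_pos` is coprime, and the tree's invariant-degree
criterion `isZariskiGenericTensor_period_eq_one_of_kronRect_pos` applies.
[cite: BurgisserIkenmeyer2017, Thm. 4.2] -/
theorem isZariskiGenericTensor_period_eq_one_of_polystable_witness {m : ℕ}
    {w₀ : Fin m → Fin m → Fin m → ℂ} (hw₀ : w₀ ≠ 0) (hps : IsPolystableTensor w₀)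
    (ha : tensorStabilizerPeriod w₀ = 1) :
    IsZariskiGenericTensor fun w : Fin m → Fin m → Fin m → ℂ => tensorStabilizerPeriod w = 1 := by
  obtain ⟨δ, h₁, h₂⟩ := exists_kronRect_pos_and_kronRect_add_period_pos hw₀ hps
  rw [ha] at h₂
  exact isZariskiGenericTensor_period_eq_one_of_kronRect_pos (pos_of_tensor_ne_zero hw₀) h₁ h₂
    (coprime_self_succ δ)

/-- The set `{δ : k_m(δ) > 0}` (`= E(m)/m`, `m ≥ 1`) is a numerical monoid: it contains `0` …
[cite: BurgisserIkenmeyer2017, §5 eq. (5.1)–(5.2)] -/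
theorem kronRect_zero_pos {m : ℕ} (hm : 0 < m) : 0 < kronRect ℂ m 0 := by
  have h := zero_mem_genericTensorDegreeMonoid (ι := Fin m) (k := ℂ)
  rw [genericTensorDegreeMonoid_eq_kronRect m] at h
  obtain ⟨δ, hδ, hk⟩ := h
  rcases Nat.eq_zero_or_pos δ with rfl | hδ0
  · exact hk
  · exact absurd hδ.symm (Nat.mul_pos hm hδ0).ne'

/-- … and is closed under addition (products of nonzero invariants).
[cite: BurgisserIkenmeyer2017, §5 eq. (5.1)–(5.2)] -/
theorem kronRect_add_pos {m δ₁ δ₂ : ℕ} (hm : 0 < m) (h₁ : 0 < kronRect ℂ m δ₁)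
    (h₂ : 0 < kronRect ℂ m δ₂) : 0 < kronRect ℂ m (δ₁ + δ₂) := by
  have hd₁ : m * δ₁ ∈ genericTensorDegreeMonoid (Fin m) ℂ := by
    rw [genericTensorDegreeMonoid_eq_kronRect]; exact ⟨δ₁, rfl, h₁⟩
  have hd₂ : m * δ₂ ∈ genericTensorDegreeMonoid (Fin m) ℂ := by
    rw [genericTensorDegreeMonoid_eq_kronRect]; exact ⟨δ₂, rfl, h₂⟩
  have h := add_mem_genericTensorDegreeMonoid hd₁ hd₂
  rw [genericTensorDegreeMonoid_eq_kronRect, ← mul_add] at h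
  obtain ⟨δ, hδ, hk⟩ := h
  rwa [Nat.eq_of_mul_eq_mul_left hm hδ]

/-- **A polystable witness of ODD period suffices** (ours): if `⊗³ℂ^m` (`m ≥ 2`) contains a
polystable `w₀ ≠ 0` with `a(w₀)` odd, then `a(m) = 1`. The unit tensor `⟨m⟩` is polystable of
period `2` (Cor. 4.9, Thm. 4.3 — tree theorems), so the group generated by `{δ : k_m(δ) > 0}`
contains `2` and `a(w₀)`, hence `1` (Bezout), hence the monoid contains a consecutive pair.
[cite: BurgisserIkenmeyer2017, Thm. 4.2, Thm. 4.3, Cor. 4.9] -/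
theorem isZariskiGenericTensor_period_eq_one_of_polystable_witness_odd {m : ℕ} (hm : 2 ≤ m)
    {w₀ : Fin m → Fin m → Fin m → ℂ} (hw₀ : w₀ ≠ 0) (hps : IsPolystableTensor w₀)
    (ha : Odd (tensorStabilizerPeriod w₀)) :
    IsZariskiGenericTensor fun w : Fin m → Fin m → Fin m → ℂ => tensorStabilizerPeriod w = 1 := by
  have hm0 : 0 < m := by omega
  set S : Set ℕ := {δ | 0 < kronRect ℂ m δ} with hS
  have h0 : (0 : ℕ) ∈ S := kronRect_zero_pos hm0
  have hadd : ∀ {a b : ℕ}, a ∈ S → b ∈ S → a + b ∈ S := fun ha hb => kronRect_add_pos hm0 ha hb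
  set H := AddSubgroup.closure ((fun d : ℕ => (d : ℤ)) '' S) with hH
  -- differences of elements of `S` lie in `H`
  have hdiff : ∀ {q a : ℕ}, q ∈ S → q + a ∈ S → (a : ℤ) ∈ H := by
    intro q a hq hqa
    have h : (a : ℤ) = ((q + a : ℕ) : ℤ) - (q : ℕ) := by push_cast; ring
    rw [h]
    exact H.sub_mem (AddSubgroup.subset_closure ⟨q + a, hqa, rfl⟩)
      (AddSubgroup.subset_closure ⟨q, hq, rfl⟩)
  -- `2 ∈ H` from the unit tensor, `a(w₀) ∈ H` from the witness
  have hunit_ne : unitTensor ℂ m ≠ 0 := by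
    intro h
    have h' := congr_fun (congr_fun (congr_fun h ⟨0, hm0⟩) ⟨0, hm0⟩) ⟨0, hm0⟩
    simp [unitTensor] at h'
  obtain ⟨δ₁, hδ₁, hδ₁'⟩ := exists_kronRect_pos_and_kronRect_add_period_pos hunit_ne
    (BI2017_cor_4_9_unitTensor_holds m)
  rw [(BI2017_thm_4_3_holds m).2 (by omega)] at hδ₁'
  obtain ⟨δ₂, hδ₂, hδ₂'⟩ := exists_kronRect_pos_and_kronRect_add_period_pos hw₀ hps
  have h2 : ((2 : ℕ) : ℤ) ∈ H := hdiff hδ₁ hδ₁'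
  have haH : ((tensorStabilizerPeriod w₀ : ℕ) : ℤ) ∈ H := hdiff hδ₂ hδ₂'
  -- Bezout: `1 ∈ H`
  have hgcd : Nat.gcd 2 (tensorStabilizerPeriod w₀) = 1 := Nat.coprime_two_left.mpr ha
  have h1 : (1 : ℤ) ∈ H := by
    have hb := Nat.gcd_eq_gcd_ab 2 (tensorStabilizerPeriod w₀)
    rw [hgcd, Nat.cast_one] at hb
    have h2' : (2 : ℤ) ∈ H := by exact_mod_cast h2
    rw [hb]
    refine H.add_mem ?_ ?_
    · rw [mul_comm, ← smul_eq_mul]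
      exact H.zsmul_mem h2' _
    · rw [mul_comm, ← smul_eq_mul]
      exact H.zsmul_mem haH _
  obtain ⟨q, hq, hq1⟩ := exists_succ_mem_of_one_mem_addSubgroupClosure_image h0 hadd h1
  exact isZariskiGenericTensor_period_eq_one_of_kronRect_pos hm0 hq hq1 (coprime_self_succ q)

end Witness

/-! ### Thm. 4.2 for every square format `m = n²` (witness `⟨n,n,n⟩`) -/

section Squares

/-- **BI 2017, Thm. 4.2 for `m = n²`, every `n ≥ 1`: `a(n²) = 1` — PROVED without Popov's
theorem.** The matrix multiplication tensor `⟨n,n,n⟩ ∈ ⊗³ℂ^{n²}` is polystable (Cor. 4.9, tree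
theorem `isPolystableTensor_biMatMulTensorFin`) of stabilizer period `1` (Cor. 4.6,
`tensorStabilizerPeriod_biMatMulTensorFin`), so it is a witness for
`isZariskiGenericTensor_period_eq_one_of_polystable_witness`. [cite: BurgisserIkenmeyer2017, Thm. 4.2] -/
theorem BI2017_thm_4_2_sq (n : ℕ) (hn : 1 ≤ n) :
    IsZariskiGenericTensor fun w : Fin (n * n) → Fin (n * n) → Fin (n * n) → ℂ =>
      tensorStabilizerPeriod w = 1 :=
  isZariskiGenericTensor_period_eq_one_of_polystable_witness (biMatMulTensorFin_ne_zero n hn)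
    (isPolystableTensor_biMatMulTensorFin n) (tensorStabilizerPeriod_biMatMulTensorFin n)

/-- **BI 2017, Thm. 4.2 for square `m ≥ 1` — PROVED.** [cite: BurgisserIkenmeyer2017, Thm. 4.2] -/
theorem BI2017_thm_4_2_of_isSquare {m : ℕ} (hm : 0 < m) (hsq : IsSquare m) :
    IsZariskiGenericTensor fun w : Fin m → Fin m → Fin m → ℂ => tensorStabilizerPeriod w = 1 := by
  obtain ⟨n, rfl⟩ := hsq
  have hn : 1 ≤ n := Nat.pos_of_ne_zero fun h => by rw [h, mul_zero] at hm; exact lt_irrefl 0 hm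
  exact BI2017_thm_4_2_sq n hn

/-- **BI 2017, Thm. 4.2 is equivalent to its clause "`m ≥ 7`, `m` not a square"**: the clauses
`m = 2` (period `2`), `3 ≤ m ≤ 6` and all squares (period `1`) are theorems of the tree, so the named
fact `BI2017_thm_4_2` says exactly "`a(m) = 1` for almost all `w ∈ ⊗³ℂ^m`, `m ≥ 7` non-square" —
the range where the printed proof's input is Popov's theorem (`BI2017_thm_4_2_of_popov`).
[cite: BurgisserIkenmeyer2017, Thm. 4.2] -/
theorem BI2017_thm_4_2_iff_nonsquare_seven_le :
    BI2017_thm_4_2 ↔ ∀ m : ℕ, 7 ≤ m → ¬ IsSquare m →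
      IsZariskiGenericTensor fun w : Fin m → Fin m → Fin m → ℂ => tensorStabilizerPeriod w = 1 := by
  rw [BI2017_thm_4_2_iff_seven_le]
  refine ⟨fun h m hm _ => h m hm, fun h m hm => ?_⟩
  by_cases hsq : IsSquare m
  · exact BI2017_thm_4_2_of_isSquare (by omega) hsq
  · exact h m hm hsq

end Squares

/-! ### Generic non-normality from two consecutive positive `k_m` (Reynolds-free, no Prop. 4.10) -/

section NonNormal

/-- **Almost all orbit closures are non-normal, from `k_m(δ), k_m(δ+1) > 0`** (ours; `m ≥ 2`): off
the zero set of `F G` (`F`, `G` nonzero homogeneous `SL_m³`-invariants of degrees `mδ`, `m(δ+1)`) a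
tensor `w` has `a(w) = 1` (coprime degrees, `tensorStabilizerPeriod_eq_one_of_sl3Invariants`),
`δ, δ+1 ∈ E'(w)` (`F(w)⁻¹F`, `G(w)⁻¹G` extend `φ_w^δ`, `φ_w^{δ+1}`) and `1 ∉ E'(w)` (else
`m ∈ E(w) ⊆ E(m)` by invariant lifting, i.e. `k_m(1) > 0`, but `k_m(1) = 0` for `m > 1`); and
`δ ≥ 1` for the same reason. The Reynolds-free core of Thm. 5.8 (3),
`not_isIntegrallyClosed_tensorOrbitCoordRing_of_consecutive`, then shows that `O(\overline{Gw})`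
is not integrally closed. No polystability of `w` is used. [cite: BurgisserIkenmeyer2017, Cor. 5.12 (2) and Thm. 5.8 (3)] -/
theorem isZariskiGenericTensor_not_isIntegrallyClosed_of_kronRect_pos_succ {m δ : ℕ} (hm : 2 ≤ m)
    (h₁ : 0 < kronRect ℂ m δ) (h₂ : 0 < kronRect ℂ m (δ + 1)) :
    IsZariskiGenericTensor fun w : Fin m → Fin m → Fin m → ℂ =>
      ¬ IsIntegrallyClosed (TensorOrbitCoordRing w) := by
  have hk1 : kronRect ℂ m 1 = 0 := kronRect_eq_zero_of_sq_lt ℂ one_pos (by omega)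
  have hδ : 0 < δ := by
    rcases Nat.eq_zero_or_pos δ with rfl | h
    · rw [zero_add, hk1] at h₂
      exact absurd h₂ (lt_irrefl 0)
    · exact h
  have hd₁ : m * δ ∈ genericTensorDegreeMonoid (Fin m) ℂ := by
    rw [genericTensorDegreeMonoid_eq_kronRect]
    exact ⟨δ, rfl, h₁⟩
  have hd₂ : m * (δ + 1) ∈ genericTensorDegreeMonoid (Fin m) ℂ := by
    rw [genericTensorDegreeMonoid_eq_kronRect]
    exact ⟨δ + 1, rfl, h₂⟩
  obtain ⟨F, hFh, hFi, hF0⟩ := hd₁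
  obtain ⟨G, hGh, hGi, hG0⟩ := hd₂
  haveI : Nonempty (Fin m) := ⟨⟨0, by omega⟩⟩
  refine ⟨F * G, mul_ne_zero hF0 hG0, fun w hw => ?_⟩
  rw [map_mul] at hw
  have hFw : aeval (tensorPt w) F ≠ 0 := left_ne_zero_of_mul hw
  have hGw : aeval (tensorPt w) G ≠ 0 := right_ne_zero_of_mul hw
  have hFh' : F.IsHomogeneous (Fintype.card (Fin m) * δ) := by rwa [Fintype.card_fin]
  have hGh' : G.IsHomogeneous (Fintype.card (Fin m) * (δ + 1)) := by rwa [Fintype.card_fin]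
  -- `a(w) = 1`
  have ha : tensorStabilizerPeriod w = 1 :=
    tensorStabilizerPeriod_eq_one_of_sl3Invariants w hFh hFi hFw hGh hGi hGw (by
      rw [Fintype.card_fin, Nat.gcd_mul_left, coprime_self_succ δ, mul_one])
  -- `δ, δ + 1 ∈ E'(w)`
  have hδE : δ ∈ tensorExponentMonoid w := mem_tensorExponentMonoid_of_period_eq_one ha hFh' hFi hFw
  have hδ1E : δ + 1 ∈ tensorExponentMonoid w :=
    mem_tensorExponentMonoid_of_period_eq_one ha hGh' hGi hGw
  -- `1 ∉ E'(w)`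
  have h1 : 1 ∉ tensorExponentMonoid w := by
    intro h1
    have hmem := mul_mem_tensorDegreeMonoid_of_mem_tensorExponentMonoid w h1
    rw [Fintype.card_fin, ha, mul_one, mul_one] at hmem
    have hgen := tensorDegreeMonoid_subset_genericTensorDegreeMonoid w hmem
    rw [genericTensorDegreeMonoid_eq_kronRect] at hgen
    obtain ⟨δ', hδ', hk⟩ := hgen
    have hδ'1 : δ' = 1 := by
      have h : m * δ' = m * 1 := by rw [mul_one]; exact hδ'.symm
      exact Nat.eq_of_mul_eq_mul_left (by omega) h
    rw [hδ'1, hk1] at hk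
    exact lt_irrefl 0 hk
  exact not_isIntegrallyClosed_tensorOrbitCoordRing_of_consecutive w hδ hδE hδ1E h1

/-- **BI 2017, Cor. 5.12 (2) from one polystable witness of period `1`** (`m ≥ 2`): the consecutive
pair of `exists_kronRect_pos_and_kronRect_add_period_pos` feeds the criterion above.
[cite: BurgisserIkenmeyer2017, Cor. 5.12 (2)] -/
theorem BI2017_cor_5_12_part2_of_polystable_witness {m : ℕ} (hm : 2 ≤ m)
    {w₀ : Fin m → Fin m → Fin m → ℂ} (hw₀ : w₀ ≠ 0) (hps : IsPolystableTensor w₀)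
    (ha : tensorStabilizerPeriod w₀ = 1) :
    IsZariskiGenericTensor fun w : Fin m → Fin m → Fin m → ℂ =>
      ¬ IsIntegrallyClosed (TensorOrbitCoordRing w) := by
  obtain ⟨δ, h₁, h₂⟩ := exists_kronRect_pos_and_kronRect_add_period_pos hw₀ hps
  rw [ha] at h₂
  exact isZariskiGenericTensor_not_isIntegrallyClosed_of_kronRect_pos_succ hm h₁ h₂

/-- **BI 2017, Cor. 5.12 (2) for every square format `m = n²`, `n ≥ 2` — PROVED without Prop. 4.10
or Popov** (witness `⟨n,n,n⟩`). [cite: BurgisserIkenmeyer2017, Cor. 5.12 (2)] -/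
theorem BI2017_cor_5_12_part2_sq (n : ℕ) (hn : 2 ≤ n) :
    IsZariskiGenericTensor fun w : Fin (n * n) → Fin (n * n) → Fin (n * n) → ℂ =>
      ¬ IsIntegrallyClosed (TensorOrbitCoordRing w) :=
  BI2017_cor_5_12_part2_of_polystable_witness (by nlinarith) (biMatMulTensorFin_ne_zero n (by omega))
    (isPolystableTensor_biMatMulTensorFin n) (tensorStabilizerPeriod_biMatMulTensorFin n)

/-- **BI 2017, Cor. 5.12 (2) for square `m ≥ 4` — PROVED.** [cite: BurgisserIkenmeyer2017, Cor. 5.12 (2)] -/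
theorem BI2017_cor_5_12_part2_of_isSquare {m : ℕ} (hm : 2 ≤ m) (hsq : IsSquare m) :
    IsZariskiGenericTensor fun w : Fin m → Fin m → Fin m → ℂ =>
      ¬ IsIntegrallyClosed (TensorOrbitCoordRing w) := by
  obtain ⟨n, rfl⟩ := hsq
  have hn : 2 ≤ n := by
    by_contra h
    interval_cases n <;> omega
  exact BI2017_cor_5_12_part2_sq n hn

/-- **BI 2017, Cor. 5.12 (2) for `3 ≤ m ≤ 6` — PROVED without Prop. 4.10 or Popov**, from the tree's
kernel certificates `k_3(2), k_3(3) > 0`, `k_4(2), k_4(3) > 0`, `k_5(3), k_5(4) > 0`,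
`k_6(3), k_6(4) > 0` (BI Ex. 5.5/5.6). [cite: BurgisserIkenmeyer2017, Cor. 5.12 (2)] -/
theorem BI2017_cor_5_12_part2_of_le_six (m : ℕ) (h3 : 3 ≤ m) (h6 : m ≤ 6) :
    IsZariskiGenericTensor fun w : Fin m → Fin m → Fin m → ℂ =>
      ¬ IsIntegrallyClosed (TensorOrbitCoordRing w) := by
  interval_cases m
  · exact isZariskiGenericTensor_not_isIntegrallyClosed_of_kronRect_pos_succ (δ := 2) (by norm_num)
      (kronRect_three_pos (by norm_num)) (kronRect_three_pos (by norm_num))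
  · exact isZariskiGenericTensor_not_isIntegrallyClosed_of_kronRect_pos_succ (δ := 2) (by norm_num)
      (kronRect_four_pos (by norm_num)) kronRect_four_three_pos
  · exact isZariskiGenericTensor_not_isIntegrallyClosed_of_kronRect_pos_succ (δ := 3) (by norm_num)
      kronRect_five_three_pos kronRect_five_four_pos
  · exact isZariskiGenericTensor_not_isIntegrallyClosed_of_kronRect_pos_succ (δ := 3) (by norm_num)
      kronRect_six_three_pos kronRect_six_four_pos

/-- **BI 2017, Cor. 5.12 (2) at one `m ≥ 3`, the printed route**: generic period `1` (the clause of
Thm. 4.2 at `m`) and generic polystability (the clause of Prop. 4.10 at `m`) give, off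
`{F₁ F₂ X_{000} = 0}`, a nonzero polystable tensor of period `1 < √m`, to which Cor. 5.12 (1)
(`BI2017_cor_5_12_part1`, discharged in the tree) applies — t06's `BI2017_cor_5_12_of_facts`
argument, per `m`. [cite: BurgisserIkenmeyer2017, Cor. 5.12] -/
theorem BI2017_cor_5_12_part2_of_generic (m : ℕ) (hm : 3 ≤ m)
    (h42 : IsZariskiGenericTensor fun w : Fin m → Fin m → Fin m → ℂ => tensorStabilizerPeriod w = 1)
    (h410 : IsZariskiGenericTensor (IsPolystableTensor : (Fin m → Fin m → Fin m → ℂ) → Prop)) :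
    IsZariskiGenericTensor fun w : Fin m → Fin m → Fin m → ℂ =>
      ¬ IsIntegrallyClosed (TensorOrbitCoordRing w) := by
  obtain ⟨F₁, hF₁, hP₁⟩ := h42
  obtain ⟨F₂, hF₂, hP₂⟩ := h410
  obtain ⟨i₀⟩ : Nonempty (Fin m) := ⟨⟨0, by omega⟩⟩
  refine ⟨F₁ * F₂ * X (i₀, i₀, i₀), mul_ne_zero (mul_ne_zero hF₁ hF₂) (X_ne_zero _),
    fun w hw => ?_⟩
  rw [map_mul, map_mul, aeval_X] at hw
  have h1 : aeval (tensorPt w) F₁ ≠ 0 := fun h => hw (by rw [h, zero_mul, zero_mul])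
  have h2 : aeval (tensorPt w) F₂ ≠ 0 := fun h => hw (by rw [h, mul_zero, zero_mul])
  have h3 : w i₀ i₀ i₀ ≠ 0 := fun h => hw (by
    rw [show tensorPt w (i₀, i₀, i₀) = w i₀ i₀ i₀ from rfl, h, mul_zero])
  have hw0 : w ≠ 0 := fun h => h3 (by rw [h]; rfl)
  have ha : tensorStabilizerPeriod w = 1 := hP₁ w h1
  exact BI2017_cor_5_12_part1 m w (by omega) hw0 (hP₂ w h2) (by rw [ha]; exact one_pos)
    (by rw [ha]; omega)

/-- **The named fact `BI2017_cor_5_12` from the NON-SQUARE clauses `m ≥ 7` of Thm. 4.2 and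
Prop. 4.10 alone**: part 1 is the tree's theorem `BI2017_cor_5_12_part1`; part 2 is PROVED above
for `3 ≤ m ≤ 6` and all squares, and follows by the printed route at every other `m`.
[cite: BurgisserIkenmeyer2017, Cor. 5.12] -/
theorem BI2017_cor_5_12_of_nonsquare_clauses
    (h42 : ∀ m : ℕ, 7 ≤ m → ¬ IsSquare m →
      IsZariskiGenericTensor fun w : Fin m → Fin m → Fin m → ℂ => tensorStabilizerPeriod w = 1)
    (h410 : ∀ m : ℕ, 7 ≤ m → ¬ IsSquare m →
      IsZariskiGenericTensor (IsPolystableTensor : (Fin m → Fin m → Fin m → ℂ) → Prop)) :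
    BI2017_cor_5_12 := by
  refine ⟨BI2017_cor_5_12_part1, fun m hm => ?_⟩
  by_cases hsq : IsSquare m
  · exact BI2017_cor_5_12_part2_of_isSquare (by omega) hsq
  rcases Nat.lt_or_ge m 7 with hlt | hge
  · exact BI2017_cor_5_12_part2_of_le_six m hm (by omega)
  · exact BI2017_cor_5_12_part2_of_generic m hm (h42 m hge hsq) (h410 m hge hsq)

/-- **`BI2017_cor_5_12` is equivalent to its part-2 clause "`m ≥ 7`, `m` not a square"** (part 1
and the other cases of part 2 being theorems of the tree). [cite: BurgisserIkenmeyer2017, Cor. 5.12] -/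
theorem BI2017_cor_5_12_iff_nonsquare_seven_le :
    BI2017_cor_5_12 ↔ ∀ m : ℕ, 7 ≤ m → ¬ IsSquare m →
      IsZariskiGenericTensor fun w : Fin m → Fin m → Fin m → ℂ =>
        ¬ IsIntegrallyClosed (TensorOrbitCoordRing w) := by
  refine ⟨fun h m hm _ => h.2 m (by omega), fun h => ⟨BI2017_cor_5_12_part1, fun m hm => ?_⟩⟩
  by_cases hsq : IsSquare m
  · exact BI2017_cor_5_12_part2_of_isSquare (by omega) hsq
  rcases Nat.lt_or_ge m 7 with hlt | hge
  · exact BI2017_cor_5_12_part2_of_le_six m hm (by omega)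
  · exact h m hge hsq

/-- **Both named facts from Popov's theorem alone is NOT claimed**; what the tree now gives BY NAME:
`BI2017_cor_5_12` from `BI2017_thm_4_2` and the non-square clauses `m ≥ 7` of `BI2017_prop_4_10`.
[cite: BurgisserIkenmeyer2017, Cor. 5.12] -/
theorem BI2017_cor_5_12_of_thm_4_2_of_prop_4_10_nonsquare (h42 : BI2017_thm_4_2)
    (h410 : ∀ m : ℕ, 7 ≤ m → ¬ IsSquare m →
      IsZariskiGenericTensor (IsPolystableTensor : (Fin m → Fin m → Fin m → ℂ) → Prop)) :
    BI2017_cor_5_12 :=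
  BI2017_cor_5_12_of_nonsquare_clauses (fun m hm _ => h42.1 m (by omega)) h410

end NonNormal

/-! ### One ODD `δ` with `k_m(δ) > 0` suffices (the unit tensor supplies the difference `2`) -/

section OddDegree

/-- The group generated by `{δ : k_m(δ) > 0}` contains `2` (`m ≥ 2`): the unit tensor `⟨m⟩` is
polystable (Cor. 4.9) of stabilizer period `2` (Thm. 4.3), so some `δ₁, δ₁ + 2` both carry nonzero
invariants (`exists_kronRect_pos_and_kronRect_add_period_pos`).
[cite: BurgisserIkenmeyer2017, Thm. 4.3, Cor. 4.9 and Thm. 5.3] -/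
theorem two_mem_addSubgroupClosure_kronRect_pos {m : ℕ} (hm : 2 ≤ m) :
    (2 : ℤ) ∈ AddSubgroup.closure ((fun d : ℕ => (d : ℤ)) '' {δ | 0 < kronRect ℂ m δ}) := by
  have hm0 : 0 < m := by omega
  have hunit_ne : unitTensor ℂ m ≠ 0 := by
    intro h
    have h' := congr_fun (congr_fun (congr_fun h ⟨0, hm0⟩) ⟨0, hm0⟩) ⟨0, hm0⟩
    simp [unitTensor] at h'
  obtain ⟨δ₁, hδ₁, hδ₁'⟩ := exists_kronRect_pos_and_kronRect_add_period_pos hunit_ne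
    (BI2017_cor_4_9_unitTensor_holds m)
  rw [(BI2017_thm_4_3_holds m).2 (by omega)] at hδ₁'
  have h : (2 : ℤ) = ((δ₁ + 2 : ℕ) : ℤ) - (δ₁ : ℕ) := by push_cast; ring
  rw [h]
  exact AddSubgroup.sub_mem _ (AddSubgroup.subset_closure ⟨δ₁ + 2, hδ₁', rfl⟩)
    (AddSubgroup.subset_closure ⟨δ₁, hδ₁, rfl⟩)

/-- **An odd `δ` with `k_m(δ) > 0` yields a consecutive pair `k_m(q), k_m(q+1) > 0`** (`m ≥ 2`):
the group generated by the numerical monoid `{δ : k_m(δ) > 0}` contains `2` and the odd `δ`, hence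
`1` (Bezout), hence the monoid contains `q, q + 1`. [cite: BurgisserIkenmeyer2017, §5 eq. (5.2)] -/
theorem exists_kronRect_pos_succ_of_odd {m δ : ℕ} (hm : 2 ≤ m) (hδ : Odd δ)
    (hk : 0 < kronRect ℂ m δ) : ∃ q : ℕ, 0 < kronRect ℂ m q ∧ 0 < kronRect ℂ m (q + 1) := by
  have hm0 : 0 < m := by omega
  set S : Set ℕ := {δ | 0 < kronRect ℂ m δ} with hS
  have h0 : (0 : ℕ) ∈ S := kronRect_zero_pos hm0
  have hadd : ∀ {a b : ℕ}, a ∈ S → b ∈ S → a + b ∈ S := fun ha hb => kronRect_add_pos hm0 ha hb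
  set H := AddSubgroup.closure ((fun d : ℕ => (d : ℤ)) '' S) with hH
  have h2 : (2 : ℤ) ∈ H := two_mem_addSubgroupClosure_kronRect_pos hm
  have hδH : (δ : ℤ) ∈ H := AddSubgroup.subset_closure ⟨δ, hk, rfl⟩
  have hgcd : Nat.gcd 2 δ = 1 := Nat.coprime_two_left.mpr hδ
  have h1 : (1 : ℤ) ∈ H := by
    have hb := Nat.gcd_eq_gcd_ab 2 δ
    rw [hgcd, Nat.cast_one] at hb
    rw [hb]
    refine H.add_mem ?_ ?_
    · rw [mul_comm, ← smul_eq_mul]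
      exact H.zsmul_mem (by exact_mod_cast h2) _
    · rw [mul_comm, ← smul_eq_mul]
      exact H.zsmul_mem hδH _
  exact exists_succ_mem_of_one_mem_addSubgroupClosure_image h0 hadd h1

/-- **`a(m) = 1` from ONE odd `δ` with `k_m(δ) > 0`** (ours; `m ≥ 2`): by
`exists_kronRect_pos_succ_of_odd` and the coprime-degrees criterion. [cite: BurgisserIkenmeyer2017, Thm. 4.2] -/
theorem isZariskiGenericTensor_period_eq_one_of_odd_kronRect_pos {m δ : ℕ} (hm : 2 ≤ m)
    (hδ : Odd δ) (hk : 0 < kronRect ℂ m δ) :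
    IsZariskiGenericTensor fun w : Fin m → Fin m → Fin m → ℂ => tensorStabilizerPeriod w = 1 := by
  obtain ⟨q, hq, hq1⟩ := exists_kronRect_pos_succ_of_odd hm hδ hk
  exact isZariskiGenericTensor_period_eq_one_of_kronRect_pos (by omega) hq hq1 (coprime_self_succ q)

/-- **Generic non-normality from ONE odd `δ` with `k_m(δ) > 0`** (ours; `m ≥ 2`).
[cite: BurgisserIkenmeyer2017, Cor. 5.12 (2)] -/
theorem isZariskiGenericTensor_not_isIntegrallyClosed_of_odd_kronRect_pos {m δ : ℕ} (hm : 2 ≤ m)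
    (hδ : Odd δ) (hk : 0 < kronRect ℂ m δ) :
    IsZariskiGenericTensor fun w : Fin m → Fin m → Fin m → ℂ =>
      ¬ IsIntegrallyClosed (TensorOrbitCoordRing w) := by
  obtain ⟨q, hq, hq1⟩ := exists_kronRect_pos_succ_of_odd hm hδ hk
  exact isZariskiGenericTensor_not_isIntegrallyClosed_of_kronRect_pos_succ hm hq hq1

/-- **BI 2017, Thm. 4.2 for ODD `m ≥ 3`, from square Kronecker positivity `k_m(m) > 0`** —
hypothesis stated inline, in the shape of Bessenrodt–Behns 2004, Cor. 3.2 ("for a square partition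
`λ = (a^a)` the character `[a^a]` is a constituent in its Kronecker square", i.e.
`g(m×m, m×m, m×m) > 0`): for odd `m` the exponent `δ = m` is odd. (Not a named fact here; the cited
result lives in its own Literature file.) [cite: BurgisserIkenmeyer2017, Thm. 4.2] -/
theorem BI2017_thm_4_2_odd_of_kronRect_self_pos
    (h : ∀ m : ℕ, Odd m → 3 ≤ m → 0 < kronRect ℂ m m) (m : ℕ) (hodd : Odd m) (hm : 3 ≤ m) :
    IsZariskiGenericTensor fun w : Fin m → Fin m → Fin m → ℂ => tensorStabilizerPeriod w = 1 :=
  isZariskiGenericTensor_period_eq_one_of_odd_kronRect_pos (by omega) hodd (h m hodd hm)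

/-- **BI 2017, Cor. 5.12 (2) for ODD `m ≥ 3`, from square Kronecker positivity `k_m(m) > 0`**
(inline hypothesis, as above). [cite: BurgisserIkenmeyer2017, Cor. 5.12 (2)] -/
theorem BI2017_cor_5_12_part2_odd_of_kronRect_self_pos
    (h : ∀ m : ℕ, Odd m → 3 ≤ m → 0 < kronRect ℂ m m) (m : ℕ) (hodd : Odd m) (hm : 3 ≤ m) :
    IsZariskiGenericTensor fun w : Fin m → Fin m → Fin m → ℂ =>
      ¬ IsIntegrallyClosed (TensorOrbitCoordRing w) :=
  isZariskiGenericTensor_not_isIntegrallyClosed_of_odd_kronRect_pos (by omega) hodd (h m hodd hm)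

/-- **The named fact `BI2017_thm_4_2` from square Kronecker positivity (odd `m`) and its own clause
for EVEN non-square `m ≥ 8`** (the residual Popov range). [cite: BurgisserIkenmeyer2017, Thm. 4.2] -/
theorem BI2017_thm_4_2_of_kronRect_self_pos_of_even_nonsquare
    (h : ∀ m : ℕ, Odd m → 3 ≤ m → 0 < kronRect ℂ m m)
    (h' : ∀ m : ℕ, 8 ≤ m → Even m → ¬ IsSquare m →
      IsZariskiGenericTensor fun w : Fin m → Fin m → Fin m → ℂ => tensorStabilizerPeriod w = 1) :
    BI2017_thm_4_2 := by
  rw [BI2017_thm_4_2_iff_nonsquare_seven_le]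
  intro m hm hsq
  rcases Nat.even_or_odd m with he | ho
  · have h8 : 8 ≤ m := by
      rcases he with ⟨r, rfl⟩
      omega
    exact h' m h8 he hsq
  · exact BI2017_thm_4_2_odd_of_kronRect_self_pos h m ho (by omega)

/-- **The named fact `BI2017_cor_5_12` from square Kronecker positivity (odd `m`) and the clauses of
Thm. 4.2 / Prop. 4.10 for EVEN non-square `m ≥ 8`.** [cite: BurgisserIkenmeyer2017, Cor. 5.12] -/
theorem BI2017_cor_5_12_of_kronRect_self_pos_of_even_nonsquare_clauses
    (h : ∀ m : ℕ, Odd m → 3 ≤ m → 0 < kronRect ℂ m m)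
    (h42 : ∀ m : ℕ, 8 ≤ m → Even m → ¬ IsSquare m →
      IsZariskiGenericTensor fun w : Fin m → Fin m → Fin m → ℂ => tensorStabilizerPeriod w = 1)
    (h410 : ∀ m : ℕ, 8 ≤ m → Even m → ¬ IsSquare m →
      IsZariskiGenericTensor (IsPolystableTensor : (Fin m → Fin m → Fin m → ℂ) → Prop)) :
    BI2017_cor_5_12 := by
  rw [BI2017_cor_5_12_iff_nonsquare_seven_le]
  intro m hm hsq
  rcases Nat.even_or_odd m with he | ho
  · have h8 : 8 ≤ m := by
      rcases he with ⟨r, rfl⟩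
      omega
    exact BI2017_cor_5_12_part2_of_generic m (by omega) (h42 m h8 he hsq) (h410 m h8 he hsq)
  · exact BI2017_cor_5_12_part2_odd_of_kronRect_self_pos h m ho (by omega)

end OddDegree

/-! ### The format `m = 8` (odd exponent `δ = 3`: `k_8(3) > 0` is a tree certificate) -/

section FormatEight

/-- **BI 2017, Thm. 4.2, case `m = 8`: `a(8) = 1` — PROVED without Popov's theorem.** `k_8(3) > 0`
(BI Ex. 5.6: `e'(8) = 3`; tree certificate `kronRect_eight_three_pos`) is a positive `k_8` at an ODD
exponent, so `isZariskiGenericTensor_period_eq_one_of_odd_kronRect_pos` applies.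
[cite: BurgisserIkenmeyer2017, Thm. 4.2 and Ex. 5.6] -/
theorem BI2017_thm_4_2_eight :
    IsZariskiGenericTensor fun w : Fin 8 → Fin 8 → Fin 8 → ℂ => tensorStabilizerPeriod w = 1 :=
  isZariskiGenericTensor_period_eq_one_of_odd_kronRect_pos (by norm_num) (by decide)
    kronRect_eight_three_pos

/-- **BI 2017, Cor. 5.12 (2), case `m = 8` — PROVED without Prop. 4.10 or Popov** (`k_8(3) > 0`).
[cite: BurgisserIkenmeyer2017, Cor. 5.12 (2) and Ex. 5.6] -/
theorem BI2017_cor_5_12_part2_eight :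
    IsZariskiGenericTensor fun w : Fin 8 → Fin 8 → Fin 8 → ℂ =>
      ¬ IsIntegrallyClosed (TensorOrbitCoordRing w) :=
  isZariskiGenericTensor_not_isIntegrallyClosed_of_odd_kronRect_pos (by norm_num) (by decide)
    kronRect_eight_three_pos

/-- **`BI2017_thm_4_2` is equivalent to its clause "`m = 7` or `m ≥ 10` non-square"** (the cases
`m = 2`, `3 ≤ m ≤ 6`, `m = 8` and all squares being theorems of the tree).
[cite: BurgisserIkenmeyer2017, Thm. 4.2] -/
theorem BI2017_thm_4_2_iff_residual :
    BI2017_thm_4_2 ↔ ∀ m : ℕ, 7 ≤ m → m ≠ 8 → ¬ IsSquare m →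
      IsZariskiGenericTensor fun w : Fin m → Fin m → Fin m → ℂ => tensorStabilizerPeriod w = 1 := by
  rw [BI2017_thm_4_2_iff_nonsquare_seven_le]
  refine ⟨fun h m hm _ hsq => h m hm hsq, fun h m hm hsq => ?_⟩
  by_cases h8 : m = 8
  · subst h8
    exact BI2017_thm_4_2_eight
  · exact h m hm h8 hsq

/-- **`BI2017_cor_5_12` is equivalent to its part-2 clause "`m = 7` or `m ≥ 10` non-square".**
[cite: BurgisserIkenmeyer2017, Cor. 5.12] -/
theorem BI2017_cor_5_12_iff_residual :
    BI2017_cor_5_12 ↔ ∀ m : ℕ, 7 ≤ m → m ≠ 8 → ¬ IsSquare m →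
      IsZariskiGenericTensor fun w : Fin m → Fin m → Fin m → ℂ =>
        ¬ IsIntegrallyClosed (TensorOrbitCoordRing w) := by
  rw [BI2017_cor_5_12_iff_nonsquare_seven_le]
  refine ⟨fun h m hm _ hsq => h m hm hsq, fun h m hm hsq => ?_⟩
  by_cases h8 : m = 8
  · subst h8
    exact BI2017_cor_5_12_part2_eight
  · exact h m hm h8 hsq

/-- **With square Kronecker positivity for odd `m` (Bessenrodt–Behns 2004, Cor. 3.2 shape, inline),
`BI2017_thm_4_2` reduces to its clause for EVEN non-square `m ≥ 10`.**
[cite: BurgisserIkenmeyer2017, Thm. 4.2] -/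
theorem BI2017_thm_4_2_of_kronRect_self_pos_of_even_nonsquare_ten_le
    (h : ∀ m : ℕ, Odd m → 3 ≤ m → 0 < kronRect ℂ m m)
    (h' : ∀ m : ℕ, 10 ≤ m → Even m → ¬ IsSquare m →
      IsZariskiGenericTensor fun w : Fin m → Fin m → Fin m → ℂ => tensorStabilizerPeriod w = 1) :
    BI2017_thm_4_2 := by
  refine BI2017_thm_4_2_of_kronRect_self_pos_of_even_nonsquare h fun m hm he hsq => ?_
  by_cases h8 : m = 8
  · subst h8
    exact BI2017_thm_4_2_eight
  · have h9 : m ≠ 9 := fun h9 => hsq ⟨3, by omega⟩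
    exact h' m (by omega) he hsq

/-- **With square Kronecker positivity for odd `m` (inline), `BI2017_cor_5_12` reduces to the clauses
of Thm. 4.2 / Prop. 4.10 for EVEN non-square `m ≥ 10`.** [cite: BurgisserIkenmeyer2017, Cor. 5.12] -/
theorem BI2017_cor_5_12_of_kronRect_self_pos_of_even_nonsquare_clauses_ten_le
    (h : ∀ m : ℕ, Odd m → 3 ≤ m → 0 < kronRect ℂ m m)
    (h42 : ∀ m : ℕ, 10 ≤ m → Even m → ¬ IsSquare m →
      IsZariskiGenericTensor fun w : Fin m → Fin m → Fin m → ℂ => tensorStabilizerPeriod w = 1)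
    (h410 : ∀ m : ℕ, 10 ≤ m → Even m → ¬ IsSquare m →
      IsZariskiGenericTensor (IsPolystableTensor : (Fin m → Fin m → Fin m → ℂ) → Prop)) :
    BI2017_cor_5_12 := by
  rw [BI2017_cor_5_12_iff_residual]
  intro m hm h8 hsq
  rcases Nat.even_or_odd m with he | ho
  · have h10 : 10 ≤ m := by
      rcases he with ⟨r, rfl⟩
      omega
    exact BI2017_cor_5_12_part2_of_generic m (by omega) (h42 m h10 he hsq) (h410 m h10 he hsq)
  · exact BI2017_cor_5_12_part2_odd_of_kronRect_self_pos h m ho (by omega)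

end FormatEight

end Literature.Computability.AlgebraicComplexity

end
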